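import Literature.NumberTheory.GaloisRepresentations.QuadraticUnramifiedOutsideFinite
import Literature.NumberTheory.GaloisRepresentations.ModNCyclotomicCharacter
import Literature.NumberTheory.GaloisRepresentations.CyclotomicCharacterSurjectiveProofs
import Literature.NumberTheory.GaloisRepresentations.HeckeCharacterProofs
import Literature.NumberTheory.EllipticCurves.DeligneSerreWeightOneIrreducibleKroneckerWeberProofs
import Mathlib.RingTheory.Polynomial.Cyclotomic.Roots
import HarnessLib

/-!
# Open image, VIII: the Dirichlet character of an open index-two subgroup of `Γ_ℚ` (proofs file)

Theorems only.  Let `H ≤ Γ_ℚ` be an open subgroup of index `2` containing the inertia group of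
every maximal ideal of `\bar ℤ` prime to a finite set `s ∋ 2` of primes — the kernel of a
quadratic character of `Γ_ℚ` unramified outside `s`.  By the Kronecker–Weber theorem with level
control (the tree's `fixingSubgroup_adjoin_le_of_index_eq_two`, Marcus Ch. 4 Ex. 29–36),
`Gal(ℚ̄/ℚ(ζ_n)) ≤ H` for `n = 8 ∏_{q ∈ s ∖ {2}} q`, so the sign character `Γ_ℚ → Γ_ℚ/H = {±1}`
factors through the mod `n` cyclotomic character `χ_n : Γ_ℚ → (ℤ/nℤ)ˣ` (which is onto,
`Gal(ℚ(μ_n)/ℚ) ≃ (ℤ/nℤ)ˣ` — the tree's `modNCyclotomicCharacter_rat_surjective`), giving a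
**Dirichlet character `η` mod `n`, `η ≠ 1`, with
`η(p) = 1` if `Frob_p ∈ H` and `η(p) = −1` if not**, for every prime `p ∉ s`
(`OpenImage.exists_dirichletCharacter_of_index_two`; `χ_n(Frob_p) = p`).  This is the
class-field-theoretic step "a quadratic character of `Gal(ℚ̄/ℚ)` is a Dirichlet character" in
Ribet 1977, §4 (proof of Prop. (4.4): the form has CM by the quadratic character `φ`).

## References

* K. A. Ribet, *Galois representations attached to eigenforms with Nebentypus*, LNM 601 (1977),
  §4, proof of Prop. (4.4). [Ribet1977Nebentypus]
* D. A. Marcus, *Number Fields*, 2nd ed. (2018), Ch. 4, Ex. 29–36. [Marcus2018]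
* L. C. Washington, *Introduction to Cyclotomic Fields*, 2nd ed., Ch. 2 (Thm. 2.5). [Washington1997]
-/

noncomputable section

open scoped NumberField IntermediateField
open Field IsDedekindDomain NumberField Polynomial

namespace Literature.NumberTheory.EllipticCurves.ModularForms

namespace OpenImage

open Literature.NumberTheory.GaloisRepresentations Rat.HeightOneSpectrum

/-- An automorphism fixing `ζ` fixes `ℚ(ζ)` pointwise: `χ_n(σ) = 1` implies
`σ ∈ Gal(ℚ̄/ℚ(ζ))` for a primitive `n`-th root of unity `ζ`, `n > 1`. [folklore] -/
theorem mem_fixingSubgroup_of_modNCyclotomicCharacter_eq_one {n : ℕ} [NeZero n] (hn : 1 < n)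
    {ζ : AlgebraicClosure ℚ} (hζ : IsPrimitiveRoot ζ n) {σ : absoluteGaloisGroup ℚ}
    (hσ : modNCyclotomicCharacter ℚ n σ = 1) :
    σ ∈ ((IntermediateField.adjoin ℚ {ζ}).fixingSubgroup : Subgroup (absoluteGaloisGroup ℚ)) := by
  haveI : Fact (1 < n) := ⟨hn⟩
  -- `σ ζ = ζ`
  have hfix : σ • ζ = ζ := by
    rw [modNCyclotomicCharacter_spec ℚ n σ ζ hζ.pow_eq_one, hσ, Units.val_one, ZMod.val_one, pow_one]
  -- the stabiliser of `ζ` fixes `ℚ(ζ)`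
  have hle : MulAction.stabilizer (AlgebraicClosure ℚ ≃ₐ[ℚ] AlgebraicClosure ℚ) ζ ≤
      (IntermediateField.adjoin ℚ {ζ}).fixingSubgroup := by
    rw [← IntermediateField.le_iff_le, IntermediateField.adjoin_simple_le_iff, IntermediateField.mem_fixedField_iff]
    intro f hf
    exact hf
  exact hle (MulAction.mem_stabilizer_iff.2 hfix)

/-- **The Dirichlet character of an open index-two subgroup of `Γ_ℚ` unramified outside `s`.**
Let `s ∋ 2` be a finite set of primes and `H ≤ Γ_ℚ` an open subgroup of index `2` containing the
inertia group of every maximal ideal of `\bar ℤ` that contains no `q ∈ s`.  Then there are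
`n ≥ 1` all of whose prime factors lie in `s`, and a Dirichlet character `η` modulo `n` with
`η ≠ 1`, such that for every prime `p ∉ s` and every arithmetic Frobenius `σ` at a prime of
`\bar ℤ` above `p`: `η(p) = 1` if `σ ∈ H` and `η(p) = −1` if `σ ∉ H`.  (Kronecker–Weber with
level control gives `Gal(ℚ̄/ℚ(ζ_n)) ≤ H`, `n = 8 ∏_{q ∈ s∖{2}} q`; the sign character of `H`
factors through the surjection `χ_n : Γ_ℚ → (ℤ/nℤ)ˣ`; `χ_n(Frob_p) = p`.)
[cite: Ribet1977Nebentypus, §4, proof of Prop. (4.4)] -/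
theorem exists_dirichletCharacter_of_index_two (s : Finset ℕ) (hsprime : ∀ q ∈ s, q.Prime) (h2s : 2 ∈ s)
    (H : Subgroup (absoluteGaloisGroup ℚ)) (hHopen : IsOpen (H : Set (absoluteGaloisGroup ℚ)))
    (hHind : H.index = 2)
    (hHI : ∀ (𝔓 : Ideal (absIntegers (𝓞 ℚ) ℚ)), 𝔓.IsMaximal →
      (∀ q ∈ s, (q : absIntegers (𝓞 ℚ) ℚ) ∉ 𝔓) → 𝔓.inertia (absoluteGaloisGroup ℚ) ≤ H) :
    ∃ (n : ℕ) (_ : NeZero n) (η : DirichletCharacter ℂ n), η ≠ 1 ∧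
      (∀ q : ℕ, q.Prime → q ∣ n → q ∈ s) ∧
      ∀ (v : HeightOneSpectrum (𝓞 ℚ)), ((primesEquiv v : Nat.Primes) : ℕ) ∉ s →
        ∀ 𝔓 ∈ v.primesAbove, ∀ σ : absoluteGaloisGroup ℚ, IsArithFrobAt (𝓞 ℚ) σ 𝔓 →
          (σ ∈ H → η (((primesEquiv v : Nat.Primes) : ℕ) : ZMod n) = 1) ∧
          (σ ∉ H → η (((primesEquiv v : Nat.Primes) : ℕ) : ZMod n) = -1) := by
  classical
  -- the level `n = 8 ∏_{q ∈ s ∖ {2}} q` and a primitive `n`-th root of unity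
  set n : ℕ := 2 ^ 3 * ∏ q ∈ s.erase 2, q with hn
  have hprod_pos : 0 < ∏ q ∈ s.erase 2, q :=
    Finset.prod_pos fun q hq ↦ (hsprime q (Finset.mem_of_mem_erase hq)).pos
  haveI hn0 : NeZero n := ⟨by rw [hn]; positivity⟩
  have hn1 : 1 < n := by
    rw [hn]
    calc 1 < 2 ^ 3 * 1 := by norm_num
      _ ≤ 2 ^ 3 * ∏ q ∈ s.erase 2, q := Nat.mul_le_mul_left _ hprod_pos
  have hnfac : ∀ q : ℕ, q.Prime → q ∣ n → q ∈ s := by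
    intro q hq hqn
    rw [hn] at hqn
    rcases (Nat.Prime.dvd_mul hq).1 hqn with h | h
    · have := (Nat.prime_dvd_prime_iff_eq hq Nat.prime_two).1 (hq.dvd_of_dvd_pow h)
      rw [this]; exact h2s
    · obtain ⟨r, hr, hqr⟩ := (Prime.dvd_finsetProd_iff hq.prime _).1 h
      have := (Nat.prime_dvd_prime_iff_eq hq (hsprime r (Finset.mem_of_mem_erase hr))).1 hqr
      rw [this]; exact Finset.mem_of_mem_erase hr
  obtain ⟨ζ, hζ⟩ := HasEnoughRootsOfUnity.exists_primitiveRoot (AlgebraicClosure ℚ) n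
  -- Kronecker–Weber with level control: `Gal(ℚ̄/ℚ(ζ)) ≤ H`
  have hKW := fixingSubgroup_adjoin_le_of_index_eq_two s hsprime h2s hζ H hHopen hHind hHI
  -- the sign character of `H`
  have hsignmul : ∀ a b : absoluteGaloisGroup ℚ,
      (if a * b ∈ H then (1 : ℂˣ) else -1) = (if a ∈ H then (1 : ℂˣ) else -1) * (if b ∈ H then 1 else -1) := by
    intro a b
    by_cases ha : a ∈ H <;> by_cases hb : b ∈ H
    · simp [ha, hb, H.mul_mem ha hb]
    · have : a * b ∉ H := fun h ↦ hb ((Subgroup.mul_mem_iff_of_index_two hHind).1 h |>.1 ha)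
      simp [ha, hb, this]
    · have : a * b ∉ H := fun h ↦ ha ((Subgroup.mul_mem_iff_of_index_two hHind).1 h |>.2 hb)
      simp [ha, hb, this]
    · have : a * b ∈ H := (Subgroup.mul_mem_iff_of_index_two hHind).2 (iff_of_false ha hb)
      simp [ha, hb, this]
  set sgn : absoluteGaloisGroup ℚ →* ℂˣ := MonoidHom.mk' (fun τ ↦ if τ ∈ H then 1 else -1) hsignmul with hsgn
  have hsgn_apply : ∀ τ, sgn τ = if τ ∈ H then 1 else -1 := fun τ ↦ rfl
  -- it is trivial on `ker χ_n`
  set χ := modNCyclotomicCharacter ℚ n with hχ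
  have hker : χ.ker ≤ sgn.ker := by
    intro τ hτ
    rw [MonoidHom.mem_ker] at hτ ⊢
    have hmem : τ ∈ H := hKW (mem_fixingSubgroup_of_modNCyclotomicCharacter_eq_one hn1 hζ hτ)
    rw [hsgn_apply, if_pos hmem]
  -- factor through the surjection `χ_n`
  have hsurj : Function.Surjective χ := modNCyclotomicCharacter_rat_surjective n
  set η' : (ZMod n)ˣ →* ℂˣ := χ.liftOfRightInverse (Function.surjInv hsurj)
    (Function.rightInverse_surjInv hsurj) ⟨sgn, hker⟩ with hη'
  have hη'χ : ∀ τ, η' (χ τ) = sgn τ := fun τ ↦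
    χ.liftOfRightInverse_comp_apply (Function.surjInv hsurj) (Function.rightInverse_surjInv hsurj) ⟨sgn, hker⟩ τ
  set η : DirichletCharacter ℂ n := MulChar.ofUnitHom η' with hηdef
  -- `η ≠ 1`: an element outside `H`
  have hne : η ≠ 1 := by
    obtain ⟨τ₀, hτ₀⟩ : ∃ τ₀, τ₀ ∉ H := by
      by_contra hall
      push Not at hall
      have : H = ⊤ := eq_top_iff.2 fun τ _ ↦ hall τ
      rw [this, Subgroup.index_top] at hHind
      exact absurd hHind (by norm_num)
    intro h1
    have h := congrArg (fun ψ : DirichletCharacter ℂ n ↦ ψ ((χ τ₀ : (ZMod n)ˣ) : ZMod n)) h1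
    simp only [hηdef, MulChar.ofUnitHom_coe, MulChar.one_apply_coe, hη'χ, hsgn_apply, if_neg hτ₀] at h
    rw [Units.val_neg, Units.val_one] at h
    norm_num at h
  refine ⟨n, hn0, η, hne, hnfac, fun v hv 𝔓 h𝔓 σ hσ ↦ ?_⟩
  -- `χ_n(Frob_p) = p`
  set p : ℕ := ((primesEquiv v : Nat.Primes) : ℕ) with hpdef
  have hpv : p = natGenerator v := rfl
  haveI : 𝔓.IsPrime := h𝔓.1
  have hpn : ¬ p ∣ n := fun h ↦ hv (hnfac p (primesEquiv v).2 h)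
  have hnP : (n : absIntegers (𝓞 ℚ) ℚ) ∉ 𝔓 := Rat.natCast_not_mem_of_mem_primesAbove_of_not_dvd h𝔓 hpn
  have hχσ : (χ σ : ZMod n) = (p : ZMod n) := by
    rw [hχ, modNCyclotomicCharacter_eq_residueCard_of_isArithFrobAt h𝔓 hnP hσ, Rat.residueCard_eq_natGenerator v,
      ← hpv]
  have hval : η (p : ZMod n) = (sgn σ : ℂ) := by
    rw [← hχσ, hηdef, MulChar.ofUnitHom_coe, hη'χ]
  rw [hval, hsgn_apply]
  constructor
  · intro hσH; rw [if_pos hσH, Units.val_one]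
  · intro hσH; rw [if_neg hσH, Units.val_neg, Units.val_one]

end OpenImage

end Literature.NumberTheory.EllipticCurves.ModularForms
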